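import Literature.NumberTheory.Automorphic.SLTwoTreeFixedSubtreeCount          -- ★ (LH4-p13): torus-form EDGE counts `pred_card_mul_ncard_fixedEdges_succ_add_two_of_{inert,eisenstein}_torusForm`; brings ★ p855331 `UnitaryTwoRamifiedFixedSelfDualEdgesPiType` (`K₂` ↔ set-wise fixed edges at √π), ★ p847070 `UnitaryTwoRamifiedEllipticFixedModularVertices` (`K♯` ↔ vertices), ★ p855257 `SLTwoTreeEllipticFixedBallTorusForm` (vertex balls), ★ p855177 (`natCard_fixedBy_eq_ncard_fixedBy_onePlace`)
import HarnessLib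

/-!
# K2 ∕ E3 «EllipticInputs», sub-line «U3b-c RANK-ONE GERMS», leaf (S♭) `sig_K2E3CentralGermConstant`, rung 3 — `K2E3RankOneEllipticFixedPointCountRamified`:
# the `δ`-fixed cosets of the two hyperspecials of `U(Φ₂)(L⁺_v)` at a RAMIFIED non-split place of √π-type (every TAME `v`), for an elliptic `δ` whose projective descent to
# `GL₂(L⁺_v)` is a unit of an INERT resp. EISENSTEIN quadratic order of conductor exponent `n`: `K₂`-column (edges) `(q − 1)·(N + 1) + 2 = (q + 1)qⁿ ∕ 2q^{n+1}`,
# `K♯`-column (vertices) `(q − 1)·N + 2 = (q + 1)qⁿ ∕ 2q^{n+1}` — and the CLOSED FORMS, constant terms `−(q+1)∕(q−1)` (edges) ∕ `−2∕(q−1)` (vertices), all NEGATIVE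

Cell `hodgecm-mathlib` (Track B «K2-LIT»), engine E3, crux H413 = `stmt-HodgeConjecture-24833`; dealt BY NAME by the line lead (ii′) K2E4-p06 (g2) 2026-09-03T23:40:55Z (recorded by
K2E3-plan (g1)) to the free E5 hand K2E5-p11 (g2); sequel of ★ p855695 (type (1), unramified `v`) and ★ p855733 (type (2), unramified `v`).  PROOF lane, THEOREMS ONLY (no `def`,
no `instance`, no `notation`, no named-fact hypothesis, no `sorry`); `--supports stmt-HodgeConjecture-24833 --as helper` (count-neutral).

★ CENSUS (a thin measure-free layer over the cell's ramified-tree library; nothing is re-proved).  `w ∣ v` a RAMIFIED non-split CM place (`he : e(w∣v) ≠ 1`), `α ∈ L_w`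
anti-fixed (`σ_w α = −α`, `α ≠ 0`) of √π-TYPE (`|α|_w = exp(−1)`: every tame place, and the wild places of type `L⁺_v(√π)`), `ϖF` a uniformiser of `L⁺_v`; `U₂ = (cmDatum L 2 Φ₂).Local v`
acts on the tree of `SL₂(L⁺_v)` (★ `latticeTree id ϖF J`, `(q+1)`-regular, `q = #𝓀(L⁺_v)`) through the projective descent `diag(1, α)·E₂γ₂·diag(1, α)⁻¹ = s·ι_w(g)`, `g ∈ GL₂(L⁺_v)`
(★ `exists_descent_of_antiFixed`); `K₂ = cmLocalIntegralLevel` is the set-wise stabiliser of an EDGE (★ p855331 `natCard_fixedBy_cmLocalIntegralLevel_eq_ncard_fixedEdges_of_v_eq_exp_neg_one`),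
`K♯ ↔ d GL₂(𝒪_w) d⁻¹` the stabiliser of a VERTEX (★ p847070 `ncard_fixedBy_quotient_comap_modular_eq_ncard_setOf_glVertexAct`).  An elliptic `g` in TORUS FORM — `h g h⁻¹ = c·γ₁`,
`γ₁ = (a, b v_τ; b, a + b u_τ)` a unit of `𝒪[τ]`, `τ² = u_τ τ + v_τ`, `|b| = |ϖF|ⁿ` — with an INERT datum (norm form anisotropic mod `𝔭`) fixes the vertex-centred ball of radius `n`,
with an EISENSTEIN datum (`|u_τ| < 1`, `|v_τ| = |ϖF|`) the edge-centred ball (★ p855257 `SLTwoTreeEllipticFixedBallTorusForm`: `(q − 1)·#V + 2 = (q + 1)qⁿ ∕ 2q^{n+1}`; ★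
`SLTwoTreeFixedSubtreeCount` §2: `(q − 1)·(#E + 1) + 2 = …`).  TYPE DICTIONARY: `δ = s·g` is of type (1) (diagonalisable over `L_w`) iff the splitting field of `g` is `L_w` (an
Eisenstein datum of `L_w`); of type (2) iff it is the unramified quadratic field (INERT datum) or the other ramified one (Eisenstein) — every elliptic torus is one of the two shapes.
The full H-side values on `U₂ × U₁` with the same ℕ-laws are ★ `F0P3cDyRamHSideTypeTwoTorusForm` (LH4-p13); THIS FILE states the four counts for `U₂` ALONE (the currency of
(S♭): `Φ(δ, 1_{K₂}) = #Fix_δ(U₂ ⧸ K₂)·ν(K₂)`) with ★'s binder shapes verbatim, and §1 isolates the constant terms of the four laws (all negative).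
HONEST LABEL: HC_CM is proved only modulo the 7 printed citations (2 remaining named inputs: hLiu418 = stmt-HodgeConjecture-24832, h413 = stmt-HodgeConjecture-24833) until rung 0
closes; count-neutral helper (√u-type ∕ dyadic places and the dictionary «CM datum ↦ torus datum» are not here).

## References
* [Kottwitz1988] R. E. Kottwitz, *Tamagawa numbers*, Ann. of Math. 127 (1988), §2 (fixed points of an elliptic element on the building; fixed subtrees).
* [LabesseLanglands1979] J.-P. Labesse, R. P. Langlands, *L-indistinguishability for SL(2)*, Canad. J. Math. 31 (1979), §2 p. 8 (`δ_m = (q+1)q^{m−1}` ∕ `2q^m`).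
* [Tits1979] J. Tits, *Reductive groups over local fields*, PSPM 33.1 (1979), §2.7 p. 48, §3.2 p. 50 (ramified quasi-split `U(1,1)`: the building is the tree of `SL₂`).
* [Rogawski1990] J. D. Rogawski, *Automorphic Representations of Unitary Groups in Three Variables* (1990), §4.9 p. 54–56, §8.1 p. 117 (constant germ).
* [Serre1980Trees] J.-P. Serre, *Trees* (1980), Ch. I §6.1, Ch. II §1.1–§1.3.
-/

set_option autoImplicit false
-- the mandated namespace repeats the single-problem summit's segment (`HodgeConjecture.HodgeConjecture`)
set_option linter.dupNamespace false

noncomputable section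

namespace Summit.HodgeConjecture.HodgeConjecture.Cruxes.H413.K2E3RankOneEllipticFixedPointCountRamified

open MeasureTheory NumberField IsDedekindDomain Matrix MulAction ValuativeRel
open Literature.NumberTheory.Automorphic Literature.NumberTheory.Automorphic.UnitaryGroup Literature.NumberTheory.Automorphic.IntegralReduction
open Literature.NumberTheory.Automorphic.HermitianLatticeTree
open Literature.NumberTheory.Rogawski1990 Literature.NumberTheory.GaloisRepresentations
open scoped Matrix MatrixGroups WithZero ValuativeRel

/-! ## §1 Closed forms of the four ℕ-laws and their constant terms -/

section Arithmetic

/-- From the EDGE law `(q − 1)·(N + 1) + 2 = R`: `N = (R − (q + 1)) ∕ (q − 1)` in `ℚ` (`2 ≤ q`). [cite: Serre1980Trees, Ch. II §1.1] -/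
theorem cast_eq_of_pred_mul_succ_add_two_eq {q N R : ℕ} (hq : 2 ≤ q) (h : (q - 1) * (N + 1) + 2 = R) :
    (N : ℚ) = ((R : ℚ) - ((q : ℚ) + 1)) / ((q : ℚ) - 1) := by
  have hq1 : ((q : ℚ) - 1) ≠ 0 := by
    have : (2 : ℚ) ≤ q := by exact_mod_cast hq
    linarith
  have h1 : 1 ≤ q := le_trans (by norm_num) hq
  have h' := congrArg (fun m : ℕ => (m : ℚ)) h
  simp only [Nat.cast_add, Nat.cast_mul, Nat.cast_sub h1, Nat.cast_one, Nat.cast_ofNat] at h'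
  rw [eq_div_iff hq1]
  linarith

/-- From the VERTEX law `(q − 1)·N + 2 = R`: `N = (R − 2) ∕ (q − 1)` in `ℚ` (`2 ≤ q`). [cite: Serre1980Trees, Ch. II §1.1] -/
theorem cast_eq_of_pred_mul_add_two_eq {q N R : ℕ} (hq : 2 ≤ q) (h : (q - 1) * N + 2 = R) :
    (N : ℚ) = ((R : ℚ) - 2) / ((q : ℚ) - 1) := by
  have hq1 : ((q : ℚ) - 1) ≠ 0 := by
    have : (2 : ℚ) ≤ q := by exact_mod_cast hq
    linarith
  have h1 : 1 ≤ q := le_trans (by norm_num) hq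
  have h' := congrArg (fun m : ℕ => (m : ℚ)) h
  simp only [Nat.cast_add, Nat.cast_mul, Nat.cast_sub h1, Nat.cast_one, Nat.cast_ofNat] at h'
  rw [eq_div_iff hq1]
  linarith

/-- **Edges, inert datum** (`(q − 1)(N + 1) + 2 = (q + 1)qⁿ`): `N = −(q+1)∕(q−1) + ((q+1)∕(q−1))·qⁿ` — constant term `−(q+1)∕(q−1) < 0`. [cite: LabesseLanglands1979, §2 p. 8]
[cite: Rogawski1990, §8.1 p. 117] -/
theorem cast_eq_neg_add_of_edges_inert {q N n : ℕ} (hq : 2 ≤ q) (h : (q - 1) * (N + 1) + 2 = (q + 1) * q ^ n) :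
    (N : ℚ) = -(((q : ℚ) + 1) / ((q : ℚ) - 1)) + (((q : ℚ) + 1) / ((q : ℚ) - 1)) * (q : ℚ) ^ n := by
  have hq1 : ((q : ℚ) - 1) ≠ 0 := by
    have : (2 : ℚ) ≤ q := by exact_mod_cast hq
    linarith
  rw [cast_eq_of_pred_mul_succ_add_two_eq hq h]
  push_cast
  field_simp
  ring

/-- **Edges, Eisenstein datum** (`(q − 1)(N + 1) + 2 = 2q^{n+1}`): `N = −(q+1)∕(q−1) + (2q∕(q−1))·qⁿ` — constant term `−(q+1)∕(q−1) < 0`. [cite: LabesseLanglands1979, §2 p. 8]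
[cite: Rogawski1990, §8.1 p. 117] -/
theorem cast_eq_neg_add_of_edges_eisenstein {q N n : ℕ} (hq : 2 ≤ q) (h : (q - 1) * (N + 1) + 2 = 2 * q ^ (n + 1)) :
    (N : ℚ) = -(((q : ℚ) + 1) / ((q : ℚ) - 1)) + (2 * (q : ℚ) / ((q : ℚ) - 1)) * (q : ℚ) ^ n := by
  have hq1 : ((q : ℚ) - 1) ≠ 0 := by
    have : (2 : ℚ) ≤ q := by exact_mod_cast hq
    linarith
  rw [cast_eq_of_pred_mul_succ_add_two_eq hq h]
  push_cast
  field_simp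
  ring

/-- **Vertices, inert datum** (`(q − 1)N + 2 = (q + 1)qⁿ`): `N = −2∕(q−1) + ((q+1)∕(q−1))·qⁿ` — constant term `−2∕(q−1) < 0`. [cite: LabesseLanglands1979, §2 p. 8]
[cite: Rogawski1990, §8.1 p. 117] -/
theorem cast_eq_neg_add_of_vertices_inert {q N n : ℕ} (hq : 2 ≤ q) (h : (q - 1) * N + 2 = (q + 1) * q ^ n) :
    (N : ℚ) = -(2 / ((q : ℚ) - 1)) + (((q : ℚ) + 1) / ((q : ℚ) - 1)) * (q : ℚ) ^ n := by
  have hq1 : ((q : ℚ) - 1) ≠ 0 := by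
    have : (2 : ℚ) ≤ q := by exact_mod_cast hq
    linarith
  rw [cast_eq_of_pred_mul_add_two_eq hq h]
  push_cast
  field_simp
  ring

/-- **Vertices, Eisenstein datum** (`(q − 1)N + 2 = 2q^{n+1}`): `N = −2∕(q−1) + (2q∕(q−1))·qⁿ` — constant term `−2∕(q−1) < 0`. [cite: LabesseLanglands1979, §2 p. 8]
[cite: Rogawski1990, §8.1 p. 117] -/
theorem cast_eq_neg_add_of_vertices_eisenstein {q N n : ℕ} (hq : 2 ≤ q) (h : (q - 1) * N + 2 = 2 * q ^ (n + 1)) :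
    (N : ℚ) = -(2 / ((q : ℚ) - 1)) + (2 * (q : ℚ) / ((q : ℚ) - 1)) * (q : ℚ) ^ n := by
  have hq1 : ((q : ℚ) - 1) ≠ 0 := by
    have : (2 : ℚ) ≤ q := by exact_mod_cast hq
    linarith
  rw [cast_eq_of_pred_mul_add_two_eq hq h]
  push_cast
  field_simp
  ring

end Arithmetic

/-! ## §2–§3 The two hyperspecial columns on `U₂ = U(Φ₂)(L⁺_v)` at a √π-type ramified place, in torus-form tokens -/

section Place

variable (L : Type) [Field L] [NumberField L] [IsCMField L] (v : HeightOneSpectrum (𝓞 ↥(maximalRealSubfield L)))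
  (w : PlacesOver L v) (hw : IsCMField.complexConj L • w.1 = w.1)
  {α : w.1.adicCompletion L} (hα : galAdicCompletionMap (L := L) (IsCMField.complexConj L) hw α = -α) (hα0 : α ≠ 0)
  {ϖF : v.adicCompletion ↥(maximalRealSubfield L)} (hϖF : Valued.v ϖF = WithZero.exp (-1 : ℤ))
  [Finite (IsLocalRing.ResidueField 𝒪[v.adicCompletion ↥(maximalRealSubfield L)])]

omit [IsCMField L] in
/-- `2 ≤ q = #𝓀(L⁺_v)` (a finite field). [cite: Serre1980Trees, Ch. II §1.1] -/
theorem two_le_natCard_residueField : 2 ≤ Nat.card (IsLocalRing.ResidueField 𝒪[v.adicCompletion ↥(maximalRealSubfield L)]) := by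
  haveI : Nontrivial (IsLocalRing.ResidueField 𝒪[v.adicCompletion ↥(maximalRealSubfield L)]) := inferInstance
  exact Finite.one_lt_card

include hw hα hα0 hϖF in
/-- **`K₂`-COLUMN, INERT DATUM: `(q − 1)·(#Fix_{γ₂}(U₂ ⧸ K₂) + 1) + 2 = (q + 1)·qⁿ`** at a √π-type ramified place — `K₂ = cmLocalIntegralLevel` counts set-wise fixed EDGES of the tree of
`SL₂(L⁺_v)` (★ p855331) and the fixed subtree of the vertex-centred ball of radius `n` has `(q+1)(qⁿ − 1)∕(q − 1)` edges (★ `SLTwoTreeFixedSubtreeCount` §2).  Binders: the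
descent representative `g` of `E₂γ₂` (`hsg`) and its INERT torus datum, verbatim as in ★ `F0P3cDyRamHSideTypeTwoTorusForm`.
[cite: Kottwitz1988, §2] [cite: LabesseLanglands1979, §2 p. 8] [cite: Tits1979, §3.2 p. 50] -/
theorem pred_card_mul_natCard_fixedBy_cmLocalIntegralLevel_succ_add_two_of_inert (he : v.asIdeal.ramificationIdx' w.1.asIdeal ≠ 1) (hvα : Valued.v α = WithZero.exp (-1 : ℤ))
    (γ₂ : ((cmDatum L 2 (Matrix.of fun i j : Fin 2 => if i.val + j.val + 1 = 2 then (1 : L) else 0)).Local v))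
    -- the descent representative `g ∈ GL₂(L⁺_v)` of `E₂ γ₂` (★ `exists_descent_of_antiFixed`)
    {s : w.1.adicCompletion L} {g : GL (Fin 2) (v.adicCompletion ↥(maximalRealSubfield L))} (hs : s ≠ 0)
    (hsg : Matrix.diagonal ![1, α] * ((((localNonsplitEquiv (IsCMField.complexConj L) (Matrix.of fun i j : Fin 2 => if i.val + j.val + 1 = 2 then (1 : L) else 0) (IsCMField.complexConj_ne_one L) w hw) γ₂ : ↥(unitaryGroupOfForm (galAdicCompletionMap (L := L) (IsCMField.complexConj L) hw) (placeForm (Matrix.of fun i j : Fin 2 => if i.val + j.val + 1 = 2 then (1 : L) else 0) w.1))) : GL (Fin 2) (w.1.adicCompletion L)) : Matrix (Fin 2) (Fin 2) (w.1.adicCompletion L)) * Matrix.diagonal ![1, α⁻¹] =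
      s • (g : Matrix (Fin 2) (Fin 2) (v.adicCompletion ↥(maximalRealSubfield L))).map (toPlace v w))
    -- the INERT torus datum of `g`: `h g h⁻¹ = c·γ₁`, `γ₁ = (a, b vτ; b, a + b uτ)` a unit of the inert order, `|b| = |ϖ|ⁿ`
    {uτ vτ : v.adicCompletion ↥(maximalRealSubfield L)} (hu : uτ ∈ 𝒪[v.adicCompletion ↥(maximalRealSubfield L)]) (hv : vτ ∈ 𝒪[v.adicCompletion ↥(maximalRealSubfield L)])
    (hanis : ∀ c e : v.adicCompletion ↥(maximalRealSubfield L), c ∈ 𝒪[v.adicCompletion ↥(maximalRealSubfield L)] → e ∈ 𝒪[v.adicCompletion ↥(maximalRealSubfield L)] → valuation (v.adicCompletion ↥(maximalRealSubfield L)) (c ^ 2 + c * e * uτ - e ^ 2 * vτ) < 1 → valuation (v.adicCompletion ↥(maximalRealSubfield L)) c < 1 ∧ valuation (v.adicCompletion ↥(maximalRealSubfield L)) e < 1)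
    {h γ₁ : GL (Fin 2) (v.adicCompletion ↥(maximalRealSubfield L))} {c a b : v.adicCompletion ↥(maximalRealSubfield L)} (hc : c ≠ 0)
    (hconj : ((h * g * h⁻¹ : GL (Fin 2) (v.adicCompletion ↥(maximalRealSubfield L))) : Matrix (Fin 2) (Fin 2) (v.adicCompletion ↥(maximalRealSubfield L))) = c • (γ₁ : Matrix (Fin 2) (Fin 2) (v.adicCompletion ↥(maximalRealSubfield L))))
    (hγ₁ : (γ₁ : Matrix (Fin 2) (Fin 2) (v.adicCompletion ↥(maximalRealSubfield L))) = !![a, b * vτ; b, a + b * uτ]) (ha : a ∈ 𝒪[v.adicCompletion ↥(maximalRealSubfield L)]) (hb : b ∈ 𝒪[v.adicCompletion ↥(maximalRealSubfield L)])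
    (hγ₁det : valuation (v.adicCompletion ↥(maximalRealSubfield L)) (γ₁ : Matrix (Fin 2) (Fin 2) (v.adicCompletion ↥(maximalRealSubfield L))).det = 1) {n : ℕ} (hbn : valuation (v.adicCompletion ↥(maximalRealSubfield L)) b = valuation (v.adicCompletion ↥(maximalRealSubfield L)) ϖF ^ n)
    (v₀ : {M : Submodule 𝒪[v.adicCompletion ↥(maximalRealSubfield L)] (Fin 2 → v.adicCompletion ↥(maximalRealSubfield L)) // IsSpecialLattice (RingHom.id _) ϖF !![(0 : v.adicCompletion ↥(maximalRealSubfield L)), 1; -1, 0] M}) (hv₀ : v₀.1 = latt (1 : Matrix (Fin 2) (Fin 2) (v.adicCompletion ↥(maximalRealSubfield L)))) :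
    (Nat.card (IsLocalRing.ResidueField 𝒪[v.adicCompletion ↥(maximalRealSubfield L)]) - 1) * (Nat.card (fixedBy (((cmDatum L 2 (Matrix.of fun i j : Fin 2 => if i.val + j.val + 1 = 2 then (1 : L) else 0)).Local v) ⧸ cmLocalIntegralLevel L 2 (Matrix.of fun i j : Fin 2 => if i.val + j.val + 1 = 2 then (1 : L) else 0) v) γ₂) + 1) + 2 = (Nat.card (IsLocalRing.ResidueField 𝒪[v.adicCompletion ↥(maximalRealSubfield L)]) + 1) * Nat.card (IsLocalRing.ResidueField 𝒪[v.adicCompletion ↥(maximalRealSubfield L)]) ^ n := by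
  haveI : IsDiscreteValuationRing 𝒪[v.adicCompletion ↥(maximalRealSubfield L)] := isDiscreteValuationRing_integer_of_compatible hϖF
  rw [natCard_fixedBy_cmLocalIntegralLevel_eq_ncard_fixedEdges_of_v_eq_exp_neg_one L v w hw hα hα0 hϖF he hvα γ₂ hs hsg]
  exact pred_card_mul_ncard_fixedEdges_succ_add_two_of_inert_torusForm (isUniformizingElement_of_v_eq hϖF) hu hv hanis hc hconj hγ₁ ha hb hγ₁det hbn v₀ hv₀

include hw hα hα0 hϖF in
/-- **`K₂`-COLUMN, EISENSTEIN DATUM: `(q − 1)·(#Fix_{γ₂}(U₂ ⧸ K₂) + 1) + 2 = 2·q^{n+1}`** at a √π-type ramified place (edge-centred ball of radius `n`: `2(q^{n+1} − 1)∕(q − 1)`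
vertices, one edge fewer). [cite: Kottwitz1988, §2] [cite: LabesseLanglands1979, §2 p. 8] [cite: Serre1979, Ch. I §6] -/
theorem pred_card_mul_natCard_fixedBy_cmLocalIntegralLevel_succ_add_two_of_eisenstein (he : v.asIdeal.ramificationIdx' w.1.asIdeal ≠ 1) (hvα : Valued.v α = WithZero.exp (-1 : ℤ))
    (γ₂ : ((cmDatum L 2 (Matrix.of fun i j : Fin 2 => if i.val + j.val + 1 = 2 then (1 : L) else 0)).Local v))
    -- the descent representative `g ∈ GL₂(L⁺_v)` of `E₂ γ₂` (★ `exists_descent_of_antiFixed`)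
    {s : w.1.adicCompletion L} {g : GL (Fin 2) (v.adicCompletion ↥(maximalRealSubfield L))} (hs : s ≠ 0)
    (hsg : Matrix.diagonal ![1, α] * ((((localNonsplitEquiv (IsCMField.complexConj L) (Matrix.of fun i j : Fin 2 => if i.val + j.val + 1 = 2 then (1 : L) else 0) (IsCMField.complexConj_ne_one L) w hw) γ₂ : ↥(unitaryGroupOfForm (galAdicCompletionMap (L := L) (IsCMField.complexConj L) hw) (placeForm (Matrix.of fun i j : Fin 2 => if i.val + j.val + 1 = 2 then (1 : L) else 0) w.1))) : GL (Fin 2) (w.1.adicCompletion L)) : Matrix (Fin 2) (Fin 2) (w.1.adicCompletion L)) * Matrix.diagonal ![1, α⁻¹] =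
      s • (g : Matrix (Fin 2) (Fin 2) (v.adicCompletion ↥(maximalRealSubfield L))).map (toPlace v w))
    -- the EISENSTEIN torus datum of `g`: `|uτ| < 1`, `|vτ| = |ϖ|`; `h g h⁻¹ = c·γ₁`, `γ₁ = (a, b vτ; b, a + b uτ)` a unit of the Eisenstein order, `|b| = |ϖ|ⁿ`
    {uτ vτ : v.adicCompletion ↥(maximalRealSubfield L)} (hu : uτ ∈ 𝒪[v.adicCompletion ↥(maximalRealSubfield L)]) (hu1 : valuation (v.adicCompletion ↥(maximalRealSubfield L)) uτ < 1) (hv1 : valuation (v.adicCompletion ↥(maximalRealSubfield L)) vτ = valuation (v.adicCompletion ↥(maximalRealSubfield L)) ϖF)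
    {h γ₁ : GL (Fin 2) (v.adicCompletion ↥(maximalRealSubfield L))} {c a b : v.adicCompletion ↥(maximalRealSubfield L)} (hc : c ≠ 0)
    (hconj : ((h * g * h⁻¹ : GL (Fin 2) (v.adicCompletion ↥(maximalRealSubfield L))) : Matrix (Fin 2) (Fin 2) (v.adicCompletion ↥(maximalRealSubfield L))) = c • (γ₁ : Matrix (Fin 2) (Fin 2) (v.adicCompletion ↥(maximalRealSubfield L))))
    (hγ₁ : (γ₁ : Matrix (Fin 2) (Fin 2) (v.adicCompletion ↥(maximalRealSubfield L))) = !![a, b * vτ; b, a + b * uτ]) (ha : a ∈ 𝒪[v.adicCompletion ↥(maximalRealSubfield L)]) (hb : b ∈ 𝒪[v.adicCompletion ↥(maximalRealSubfield L)])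
    (hγ₁det : valuation (v.adicCompletion ↥(maximalRealSubfield L)) (γ₁ : Matrix (Fin 2) (Fin 2) (v.adicCompletion ↥(maximalRealSubfield L))).det = 1) {n : ℕ} (hbn : valuation (v.adicCompletion ↥(maximalRealSubfield L)) b = valuation (v.adicCompletion ↥(maximalRealSubfield L)) ϖF ^ n)
    (v₀ : {M : Submodule 𝒪[v.adicCompletion ↥(maximalRealSubfield L)] (Fin 2 → v.adicCompletion ↥(maximalRealSubfield L)) // IsSpecialLattice (RingHom.id _) ϖF !![(0 : v.adicCompletion ↥(maximalRealSubfield L)), 1; -1, 0] M}) (hv₀ : v₀.1 = latt (1 : Matrix (Fin 2) (Fin 2) (v.adicCompletion ↥(maximalRealSubfield L)))) :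
    (Nat.card (IsLocalRing.ResidueField 𝒪[v.adicCompletion ↥(maximalRealSubfield L)]) - 1) * (Nat.card (fixedBy (((cmDatum L 2 (Matrix.of fun i j : Fin 2 => if i.val + j.val + 1 = 2 then (1 : L) else 0)).Local v) ⧸ cmLocalIntegralLevel L 2 (Matrix.of fun i j : Fin 2 => if i.val + j.val + 1 = 2 then (1 : L) else 0) v) γ₂) + 1) + 2 = 2 * Nat.card (IsLocalRing.ResidueField 𝒪[v.adicCompletion ↥(maximalRealSubfield L)]) ^ (n + 1) := by
  haveI : IsDiscreteValuationRing 𝒪[v.adicCompletion ↥(maximalRealSubfield L)] := isDiscreteValuationRing_integer_of_compatible hϖF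
  rw [natCard_fixedBy_cmLocalIntegralLevel_eq_ncard_fixedEdges_of_v_eq_exp_neg_one L v w hw hα hα0 hϖF he hvα γ₂ hs hsg]
  exact pred_card_mul_ncard_fixedEdges_succ_add_two_of_eisenstein_torusForm (isUniformizingElement_of_v_eq hϖF) hu hu1 hv1 hc hconj hγ₁ ha hb hγ₁det hbn v₀ hv₀

include hw hα hα0 hϖF in
/-- **`K♯`-COLUMN, INERT DATUM: `(q − 1)·#Fix_{γ₂}(U₂ ⧸ K♯) + 2 = (q + 1)·qⁿ`** at a √π-type ramified place — `K♯` (any subgroup matched at `w` with `d GL₂(𝒪_w) d⁻¹`, `d = diag(1, ϖ_w)`,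
`|ϖ_w| = exp(−1)`) counts fixed VERTICES (★ p855177 transport + ★ p847070 §1 + ★ p855257). [cite: Kottwitz1988, §2] [cite: LabesseLanglands1979, §2 p. 8] [cite: Tits1979, §3.2 p. 50] -/
theorem pred_card_mul_natCard_fixedBy_modular_add_two_of_inert (he : v.asIdeal.ramificationIdx' w.1.asIdeal ≠ 1) (hvα : Valued.v α = WithZero.exp (-1 : ℤ))
    (ϖ : (w.1.adicCompletion L)ˣ) (hϖ : Valued.v (ϖ : w.1.adicCompletion L) = WithZero.exp (-1 : ℤ))
    (Ksh : Subgroup ((cmDatum L 2 (Matrix.of fun i j : Fin 2 => if i.val + j.val + 1 = 2 then (1 : L) else 0)).Local v)) (hKsh : ∀ g', g' ∈ Ksh ↔ (((localNonsplitEquiv (IsCMField.complexConj L) (Matrix.of fun i j : Fin 2 => if i.val + j.val + 1 = 2 then (1 : L) else 0) (IsCMField.complexConj_ne_one L) w hw) g' : ↥(unitaryGroupOfForm (galAdicCompletionMap (L := L) (IsCMField.complexConj L) hw) (placeForm (Matrix.of fun i j : Fin 2 => if i.val + j.val + 1 = 2 then (1 : L) else 0) w.1))) : GL (Fin 2) (w.1.adicCompletion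 L)) ∈ (glInt 2 (w.1.adicCompletion L)).map (MulAut.conj (glDiagonal 2 (w.1.adicCompletion L) ![1, ϖ])).toMonoidHom)
    (γ₂ : ((cmDatum L 2 (Matrix.of fun i j : Fin 2 => if i.val + j.val + 1 = 2 then (1 : L) else 0)).Local v))
    -- the descent representative `g ∈ GL₂(L⁺_v)` of `E₂ γ₂` (★ `exists_descent_of_antiFixed`)
    {s : w.1.adicCompletion L} {g : GL (Fin 2) (v.adicCompletion ↥(maximalRealSubfield L))} (hs : s ≠ 0)
    (hsg : Matrix.diagonal ![1, α] * ((((localNonsplitEquiv (IsCMField.complexConj L) (Matrix.of fun i j : Fin 2 => if i.val + j.val + 1 = 2 then (1 : L) else 0) (IsCMField.complexConj_ne_one L) w hw) γ₂ : ↥(unitaryGroupOfForm (galAdicCompletionMap (L := L) (IsCMField.complexConj L) hw) (placeForm (Matrix.of fun i j : Fin 2 => if i.val + j.val + 1 = 2 then (1 : L) else 0) w.1))) : GL (Fin 2) (w.1.adicCompletion L)) : Matrix (Fin 2) (Fin 2) (w.1.adicCompletion L)) * Matrix.diagonal ![1, α⁻¹] =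
      s • (g : Matrix (Fin 2) (Fin 2) (v.adicCompletion ↥(maximalRealSubfield L))).map (toPlace v w))
    -- the INERT torus datum of `g`: `h g h⁻¹ = c·γ₁`, `γ₁ = (a, b vτ; b, a + b uτ)` a unit of the inert order, `|b| = |ϖ|ⁿ`
    {uτ vτ : v.adicCompletion ↥(maximalRealSubfield L)} (hu : uτ ∈ 𝒪[v.adicCompletion ↥(maximalRealSubfield L)]) (hv : vτ ∈ 𝒪[v.adicCompletion ↥(maximalRealSubfield L)])
    (hanis : ∀ c e : v.adicCompletion ↥(maximalRealSubfield L), c ∈ 𝒪[v.adicCompletion ↥(maximalRealSubfield L)] → e ∈ 𝒪[v.adicCompletion ↥(maximalRealSubfield L)] → valuation (v.adicCompletion ↥(maximalRealSubfield L)) (c ^ 2 + c * e * uτ - e ^ 2 * vτ) < 1 → valuation (v.adicCompletion ↥(maximalRealSubfield L)) c < 1 ∧ valuation (v.adicCompletion ↥(maximalRealSubfield L)) e < 1)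
    {h γ₁ : GL (Fin 2) (v.adicCompletion ↥(maximalRealSubfield L))} {c a b : v.adicCompletion ↥(maximalRealSubfield L)} (hc : c ≠ 0)
    (hconj : ((h * g * h⁻¹ : GL (Fin 2) (v.adicCompletion ↥(maximalRealSubfield L))) : Matrix (Fin 2) (Fin 2) (v.adicCompletion ↥(maximalRealSubfield L))) = c • (γ₁ : Matrix (Fin 2) (Fin 2) (v.adicCompletion ↥(maximalRealSubfield L))))
    (hγ₁ : (γ₁ : Matrix (Fin 2) (Fin 2) (v.adicCompletion ↥(maximalRealSubfield L))) = !![a, b * vτ; b, a + b * uτ]) (ha : a ∈ 𝒪[v.adicCompletion ↥(maximalRealSubfield L)]) (hb : b ∈ 𝒪[v.adicCompletion ↥(maximalRealSubfield L)])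
    (hγ₁det : valuation (v.adicCompletion ↥(maximalRealSubfield L)) (γ₁ : Matrix (Fin 2) (Fin 2) (v.adicCompletion ↥(maximalRealSubfield L))).det = 1) {n : ℕ} (hbn : valuation (v.adicCompletion ↥(maximalRealSubfield L)) b = valuation (v.adicCompletion ↥(maximalRealSubfield L)) ϖF ^ n)
    (v₀ : {M : Submodule 𝒪[v.adicCompletion ↥(maximalRealSubfield L)] (Fin 2 → v.adicCompletion ↥(maximalRealSubfield L)) // IsSpecialLattice (RingHom.id _) ϖF !![(0 : v.adicCompletion ↥(maximalRealSubfield L)), 1; -1, 0] M}) (hv₀ : v₀.1 = latt (1 : Matrix (Fin 2) (Fin 2) (v.adicCompletion ↥(maximalRealSubfield L)))) :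
    (Nat.card (IsLocalRing.ResidueField 𝒪[v.adicCompletion ↥(maximalRealSubfield L)]) - 1) * Nat.card (fixedBy (((cmDatum L 2 (Matrix.of fun i j : Fin 2 => if i.val + j.val + 1 = 2 then (1 : L) else 0)).Local v) ⧸ Ksh) γ₂) + 2 = (Nat.card (IsLocalRing.ResidueField 𝒪[v.adicCompletion ↥(maximalRealSubfield L)]) + 1) * Nat.card (IsLocalRing.ResidueField 𝒪[v.adicCompletion ↥(maximalRealSubfield L)]) ^ n := by
  haveI : IsDiscreteValuationRing 𝒪[v.adicCompletion ↥(maximalRealSubfield L)] := isDiscreteValuationRing_integer_of_compatible hϖF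
  rw [natCard_fixedBy_eq_ncard_fixedBy_onePlace L v w hw ϖ Ksh hKsh γ₂,
    ncard_fixedBy_quotient_comap_modular_eq_ncard_setOf_glVertexAct L v w hw hα hα0 hϖF he hvα ϖ hϖ _ hs hsg]
  exact ncard_setOf_glVertexAct_eq_self_of_inert_torusForm (isUniformizingElement_of_v_eq hϖF) hu hv hanis hc hconj hγ₁ ha hb hγ₁det hbn v₀ hv₀

include hw hα hα0 hϖF in
/-- **`K♯`-COLUMN, EISENSTEIN DATUM: `(q − 1)·#Fix_{γ₂}(U₂ ⧸ K♯) + 2 = 2·q^{n+1}`** at a √π-type ramified place (the edge-centred ball of radius `n`).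
[cite: Kottwitz1988, §2] [cite: LabesseLanglands1979, §2 p. 8] [cite: Serre1979, Ch. I §6] -/
theorem pred_card_mul_natCard_fixedBy_modular_add_two_of_eisenstein (he : v.asIdeal.ramificationIdx' w.1.asIdeal ≠ 1) (hvα : Valued.v α = WithZero.exp (-1 : ℤ))
    (ϖ : (w.1.adicCompletion L)ˣ) (hϖ : Valued.v (ϖ : w.1.adicCompletion L) = WithZero.exp (-1 : ℤ))
    (Ksh : Subgroup ((cmDatum L 2 (Matrix.of fun i j : Fin 2 => if i.val + j.val + 1 = 2 then (1 : L) else 0)).Local v)) (hKsh : ∀ g', g' ∈ Ksh ↔ (((localNonsplitEquiv (IsCMField.complexConj L) (Matrix.of fun i j : Fin 2 => if i.val + j.val + 1 = 2 then (1 : L) else 0) (IsCMField.complexConj_ne_one L) w hw) g' : ↥(unitaryGroupOfForm (galAdicCompletionMap (L := L) (IsCMField.complexConj L) hw) (placeForm (Matrix.of fun i j : Fin 2 => if i.val + j.val + 1 = 2 then (1 : L) else 0) w.1))) : GL (Fin 2) (w.1.adicCompletion L)) ∈ (glInt 2 (w.1.adicCompletion L)).map (MulAut.conj (glDiagonal 2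 (w.1.adicCompletion L) ![1, ϖ])).toMonoidHom)
    (γ₂ : ((cmDatum L 2 (Matrix.of fun i j : Fin 2 => if i.val + j.val + 1 = 2 then (1 : L) else 0)).Local v))
    -- the descent representative `g ∈ GL₂(L⁺_v)` of `E₂ γ₂` (★ `exists_descent_of_antiFixed`)
    {s : w.1.adicCompletion L} {g : GL (Fin 2) (v.adicCompletion ↥(maximalRealSubfield L))} (hs : s ≠ 0)
    (hsg : Matrix.diagonal ![1, α] * ((((localNonsplitEquiv (IsCMField.complexConj L) (Matrix.of fun i j : Fin 2 => if i.val + j.val + 1 = 2 then (1 : L) else 0) (IsCMField.complexConj_ne_one L) w hw) γ₂ : ↥(unitaryGroupOfForm (galAdicCompletionMap (L := L) (IsCMField.complexConj L) hw) (placeForm (Matrix.of fun i j : Fin 2 => if i.val + j.val + 1 = 2 then (1 : L) else 0) w.1))) : GL (Fin 2) (w.1.adicCompletion L)) : Matrix (Fin 2) (Fin 2) (w.1.adicCompletion L)) * Matrix.diagonal ![1, α⁻¹] =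
      s • (g : Matrix (Fin 2) (Fin 2) (v.adicCompletion ↥(maximalRealSubfield L))).map (toPlace v w))
    -- the EISENSTEIN torus datum of `g`: `|uτ| < 1`, `|vτ| = |ϖ|`; `h g h⁻¹ = c·γ₁`, `γ₁ = (a, b vτ; b, a + b uτ)` a unit of the Eisenstein order, `|b| = |ϖ|ⁿ`
    {uτ vτ : v.adicCompletion ↥(maximalRealSubfield L)} (hu : uτ ∈ 𝒪[v.adicCompletion ↥(maximalRealSubfield L)]) (hu1 : valuation (v.adicCompletion ↥(maximalRealSubfield L)) uτ < 1) (hv1 : valuation (v.adicCompletion ↥(maximalRealSubfield L)) vτ = valuation (v.adicCompletion ↥(maximalRealSubfield L)) ϖF)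
    {h γ₁ : GL (Fin 2) (v.adicCompletion ↥(maximalRealSubfield L))} {c a b : v.adicCompletion ↥(maximalRealSubfield L)} (hc : c ≠ 0)
    (hconj : ((h * g * h⁻¹ : GL (Fin 2) (v.adicCompletion ↥(maximalRealSubfield L))) : Matrix (Fin 2) (Fin 2) (v.adicCompletion ↥(maximalRealSubfield L))) = c • (γ₁ : Matrix (Fin 2) (Fin 2) (v.adicCompletion ↥(maximalRealSubfield L))))
    (hγ₁ : (γ₁ : Matrix (Fin 2) (Fin 2) (v.adicCompletion ↥(maximalRealSubfield L))) = !![a, b * vτ; b, a + b * uτ]) (ha : a ∈ 𝒪[v.adicCompletion ↥(maximalRealSubfield L)]) (hb : b ∈ 𝒪[v.adicCompletion ↥(maximalRealSubfield L)])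
    (hγ₁det : valuation (v.adicCompletion ↥(maximalRealSubfield L)) (γ₁ : Matrix (Fin 2) (Fin 2) (v.adicCompletion ↥(maximalRealSubfield L))).det = 1) {n : ℕ} (hbn : valuation (v.adicCompletion ↥(maximalRealSubfield L)) b = valuation (v.adicCompletion ↥(maximalRealSubfield L)) ϖF ^ n)
    (v₀ : {M : Submodule 𝒪[v.adicCompletion ↥(maximalRealSubfield L)] (Fin 2 → v.adicCompletion ↥(maximalRealSubfield L)) // IsSpecialLattice (RingHom.id _) ϖF !![(0 : v.adicCompletion ↥(maximalRealSubfield L)), 1; -1, 0] M}) (hv₀ : v₀.1 = latt (1 : Matrix (Fin 2) (Fin 2) (v.adicCompletion ↥(maximalRealSubfield L)))) :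
    (Nat.card (IsLocalRing.ResidueField 𝒪[v.adicCompletion ↥(maximalRealSubfield L)]) - 1) * Nat.card (fixedBy (((cmDatum L 2 (Matrix.of fun i j : Fin 2 => if i.val + j.val + 1 = 2 then (1 : L) else 0)).Local v) ⧸ Ksh) γ₂) + 2 = 2 * Nat.card (IsLocalRing.ResidueField 𝒪[v.adicCompletion ↥(maximalRealSubfield L)]) ^ (n + 1) := by
  haveI : IsDiscreteValuationRing 𝒪[v.adicCompletion ↥(maximalRealSubfield L)] := isDiscreteValuationRing_integer_of_compatible hϖF
  rw [natCard_fixedBy_eq_ncard_fixedBy_onePlace L v w hw ϖ Ksh hKsh γ₂,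
    ncard_fixedBy_quotient_comap_modular_eq_ncard_setOf_glVertexAct L v w hw hα hα0 hϖF he hvα ϖ hϖ _ hs hsg]
  exact ncard_setOf_glVertexAct_eq_self_of_eisenstein_torusForm (isUniformizingElement_of_v_eq hϖF) hu hu1 hv1 hc hconj hγ₁ ha hb hγ₁det hbn v₀ hv₀

end Place

end Summit.HodgeConjecture.HodgeConjecture.Cruxes.H413.K2E3RankOneEllipticFixedPointCountRamified

end
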